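import Summits.Ventures.HodgeRepro2.A2Galois

/-!
# Lemma A4.2.2 (ii), the rationality paragraph — the eigenvalue sets `Λ`, `Λ_W` are Galois-stable

Blind cell pub-hodge-repro2, seat p6 (sub-claim A2 annex, Tier 4). Imports my row 4 (`A2Galois`: the Lagrange
indicator `lagrangeIndicator Λ Λ_W` and `coeff_lagrangeIndicator_mem_range`, which takes the Galois-stability of `Λ`
and `Λ_W` as HYPOTHESES).

THE PROSE (route/T4-A2-p6.md, Lemma A4.2.2 and its proof): «Put Λ := {σ(x)σ'(x) : σ ≠ σ' ∈ Σ} ⊂ F_1 (the set of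
eigenvalues of ι_i(x)^* ⊗ ℂ on H²(X, ℂ)), Λ_W := {τ_ν(x)τ̄_ν(x) : ν = 1, 2, 3} ⊂ Λ … Rationality: for
g ∈ Gal(F_1/ℚ), g(σ(x)σ'(x)) = (g∘σ)(x)(g∘σ')(x), and σ ↦ g∘σ is a permutation of Σ which commutes with the bar
(σ̄ := σ ∘ c by A0.1, so (g∘σ)‾ = g∘σ∘c = g∘σ̄); hence g permutes Λ and permutes Λ_W (the set of the values
σ(x)σ̄(x), σ ∈ Σ), so applying g to the coefficients of P_2 permutes its summands and factors and P_2^g = P_2: the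
coefficients lie in F_1^{Gal(F_1/ℚ)} = ℚ.»

WHAT IS PROVED HERE (K ⊂ F, K ⊂ L fields; Σ = the K-algebra maps F → L, finitely many; c : F → F a K-algebra map, the
CM involution of A0.1; x ∈ F):
* `eigSet K x` = {σ(x)σ'(x) : σ ≠ σ'} and `pairSet c x` = {σ(x) σ(c x) : σ} as Finsets of L, with
  `pairSet_subset_eigSet` (Λ_W ⊂ Λ when c ≠ id: σ ∘ c ≠ σ for every σ).
* **`map_eigSet`** / **`map_pairSet`** — every K-algebra map g : L → L maps Λ into Λ and Λ_W into Λ_W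
  (g(σ(x)σ'(x)) = (g∘σ)(x)(g∘σ')(x), and g∘σ ≠ g∘σ' for σ ≠ σ' since g is injective); `image_eigSet_eq` /
  `image_pairSet_eq` — a K-automorphism permutes them (row 4's `image_eq_self_of_mapsTo`).
* **`coeff_lagrangeIndicator_eigSet_mem_range`** / **`exists_polynomial_eigSet`** — Lemma A4.2.2 (ii) CLOSED: for L/K
  Galois, the Lagrange indicator P_2 of (Λ(x), Λ_W(x)) has all its coefficients in K (row 4's theorem with its two
  stability hypotheses now discharged); `lagrangeIndicator_eigSet_eval` — P_2 = 1 on Λ_W, 0 on Λ ∖ Λ_W.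
What stays prose: that Λ is the set of eigenvalues of ι_i(x)^* ⊗ ℂ on H²(X, ℂ) = ∧² H¹ (A0.4) and that
P_2(ι_i(x)^*) is the projector onto ⊕_ν ℓ_{i,τ_ν} ∧ ℓ_{i,τ̄_ν} (the seed BridgeProjector of p4, row 11's base change).
§8(d) declaration: uses an L-value-free non-vanishing device: NO.
-/

namespace Summit.Ventures.HodgeRepro2.A2EigenvalueSetsStable

open Summit.Ventures.HodgeRepro2.A2Galois

variable {K F L : Type*} [Field K] [Field F] [Field L] [Algebra K F] [Algebra K L]

/-- `Λ(x) = {σ(x)σ'(x) : σ ≠ σ' ∈ Σ}`: the eigenvalues of `ι(x)^*` on `H² = ∧² H¹` (A0.4), as a Finset of `L`. -/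
def eigSet (K : Type*) [Field K] [Algebra K F] [Algebra K L] [Fintype (F →ₐ[K] L)] [DecidableEq L]
    [DecidableEq (F →ₐ[K] L)] (x : F) : Finset L :=
  ((Finset.univ : Finset ((F →ₐ[K] L) × (F →ₐ[K] L))).filter fun p => p.1 ≠ p.2).image fun p => p.1 x * p.2 x

/-- `Λ_W(x) = {σ(x) σ(c x) : σ ∈ Σ}`: the eigenvalues on the conjugate-pair lines `ℓ_σ ∧ ℓ_σ̄`, `σ̄ := σ ∘ c` (A0.1). -/
def pairSet [Fintype (F →ₐ[K] L)] [DecidableEq L] (c : F →ₐ[K] F) (x : F) : Finset L :=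
  (Finset.univ : Finset (F →ₐ[K] L)).image fun σ => σ x * σ (c x)

variable [Fintype (F →ₐ[K] L)] [DecidableEq L] [DecidableEq (F →ₐ[K] L)]

/-- Membership in `Λ(x)`. -/
lemma mem_eigSet_iff {x : F} {y : L} :
    y ∈ (eigSet K x : Finset L) ↔ ∃ σ σ' : F →ₐ[K] L, σ ≠ σ' ∧ σ x * σ' x = y := by
  unfold eigSet
  simp only [Finset.mem_image, Finset.mem_filter, Finset.mem_univ, true_and, Prod.exists]

omit [DecidableEq (F →ₐ[K] L)] in
/-- Membership in `Λ_W(x)`. -/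
lemma mem_pairSet_iff {c : F →ₐ[K] F} {x : F} {y : L} :
    y ∈ (pairSet c x : Finset L) ↔ ∃ σ : F →ₐ[K] L, σ x * σ (c x) = y := by
  unfold pairSet
  simp only [Finset.mem_image, Finset.mem_univ, true_and]

omit [Fintype (F →ₐ[K] L)] [DecidableEq L] [DecidableEq (F →ₐ[K] L)] in
/-- `σ ∘ c ≠ σ` for every embedding `σ` when `c ≠ id` (an embedding is injective). -/
lemma comp_ne_self_of_ne_id {c : F →ₐ[K] F} (hc : c ≠ AlgHom.id K F) (σ : F →ₐ[K] L) : σ.comp c ≠ σ := by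
  intro h
  apply hc
  ext y
  have hy := congrArg (fun φ : F →ₐ[K] L => φ y) h
  simp only [AlgHom.comp_apply] at hy
  exact σ.toRingHom.injective hy

/-- `Λ_W(x) ⊂ Λ(x)` when `c ≠ id` (the prose's «Λ_W ⊂ Λ»: each pair `{σ, σ̄}` consists of two distinct embeddings). -/
theorem pairSet_subset_eigSet {c : F →ₐ[K] F} (hc : c ≠ AlgHom.id K F) (x : F) :
    (pairSet c x : Finset L) ⊆ eigSet K x := by
  intro y hy
  obtain ⟨σ, rfl⟩ := mem_pairSet_iff.mp hy
  exact mem_eigSet_iff.mpr ⟨σ, σ.comp c, (comp_ne_self_of_ne_id hc σ).symm, by rw [AlgHom.comp_apply]⟩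

omit [Fintype (F →ₐ[K] L)] [DecidableEq L] [DecidableEq (F →ₐ[K] L)] in
/-- `g ∘ σ ≠ g ∘ σ'` for `σ ≠ σ'` and an embedding `g` (injective). -/
lemma comp_ne_comp {g : L →ₐ[K] L} {σ σ' : F →ₐ[K] L} (h : σ ≠ σ') : g.comp σ ≠ g.comp σ' := by
  intro h'
  apply h
  ext y
  have hy := congrArg (fun φ : F →ₐ[K] L => φ y) h'
  simp only [AlgHom.comp_apply] at hy
  exact g.toRingHom.injective hy

/-- **`g` maps `Λ(x)` into `Λ(x)`**: `g(σ(x)σ'(x)) = (g∘σ)(x)(g∘σ')(x)` with `g∘σ ≠ g∘σ'`. -/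
theorem map_eigSet (g : L →ₐ[K] L) (x : F) : ∀ y ∈ (eigSet K x : Finset L), g y ∈ (eigSet K x : Finset L) := by
  intro y hy
  obtain ⟨σ, σ', h, rfl⟩ := mem_eigSet_iff.mp hy
  exact mem_eigSet_iff.mpr ⟨g.comp σ, g.comp σ', comp_ne_comp h, by simp⟩

omit [DecidableEq (F →ₐ[K] L)] in
/-- **`g` maps `Λ_W(x)` into `Λ_W(x)`**: `g(σ(x)σ(cx)) = (g∘σ)(x)(g∘σ)(cx)` — «σ ↦ g∘σ commutes with the bar». -/
theorem map_pairSet (g : L →ₐ[K] L) (c : F →ₐ[K] F) (x : F) :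
    ∀ y ∈ (pairSet c x : Finset L), g y ∈ (pairSet c x : Finset L) := by
  intro y hy
  obtain ⟨σ, rfl⟩ := mem_pairSet_iff.mp hy
  exact mem_pairSet_iff.mpr ⟨g.comp σ, by simp⟩

/-- A K-automorphism of `L` permutes `Λ(x)` (row 4's `image_eq_self_of_mapsTo`). -/
theorem image_eigSet_eq (g : L ≃ₐ[K] L) (x : F) : (eigSet K x : Finset L).image g = eigSet K x :=
  image_eq_self_of_mapsTo g.injective _ (map_eigSet g.toAlgHom x)

omit [DecidableEq (F →ₐ[K] L)] in
/-- A K-automorphism of `L` permutes `Λ_W(x)`. -/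
theorem image_pairSet_eq (g : L ≃ₐ[K] L) (c : F →ₐ[K] F) (x : F) :
    (pairSet c x : Finset L).image g = pairSet c x :=
  image_eq_self_of_mapsTo g.injective _ (map_pairSet g.toAlgHom c x)

/-- The Galois-stability hypotheses of row 4 in the form it takes them (`Gal(L/K) = L ≃ₐ[K] L`). -/
theorem gal_maps_eigSet (x : F) : ∀ g : L ≃ₐ[K] L, ∀ y ∈ (eigSet K x : Finset L), g y ∈ (eigSet K x : Finset L) :=
  fun g => map_eigSet g.toAlgHom x

omit [DecidableEq (F →ₐ[K] L)] in
/-- The Galois-stability hypothesis of row 4 for `Λ_W`. -/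
theorem gal_maps_pairSet (c : F →ₐ[K] F) (x : F) :
    ∀ g : L ≃ₐ[K] L, ∀ y ∈ (pairSet c x : Finset L), g y ∈ (pairSet c x : Finset L) :=
  fun g => map_pairSet g.toAlgHom c x

/-- **Lemma A4.2.2 (ii), closed**: for `L/K` Galois the Lagrange indicator `P_2` of `(Λ(x), Λ_W(x))` has all its
coefficients in `K` (row 4's `coeff_lagrangeIndicator_mem_range`, its two stability hypotheses discharged). -/
theorem coeff_lagrangeIndicator_eigSet_mem_range [IsGalois K L] [FiniteDimensional K L] (c : F →ₐ[K] F) (x : F)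
    (n : ℕ) : (lagrangeIndicator (eigSet K x : Finset L) (pairSet c x)).coeff n ∈ (algebraMap K L).range :=
  coeff_lagrangeIndicator_mem_range _ _ (gal_maps_eigSet x) (gal_maps_pairSet c x) n

/-- `P_2 ∈ K[T]`: a polynomial over `K` whose base change to `L` is the Lagrange indicator of `(Λ(x), Λ_W(x))`. -/
theorem exists_polynomial_eigSet [IsGalois K L] [FiniteDimensional K L] (c : F →ₐ[K] F) (x : F) :
    ∃ Q : Polynomial K, Q.map (algebraMap K L) = lagrangeIndicator (eigSet K x : Finset L) (pairSet c x) :=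
  exists_polynomial_map_eq_lagrangeIndicator _ _ (gal_maps_eigSet x) (gal_maps_pairSet c x)

/-- The interpolation property in this setting: `P_2(λ) = 1` for `λ ∈ Λ_W(x)`, `P_2(μ) = 0` for `μ ∈ Λ(x) ∖ Λ_W(x)`
(row 4's `lagrangeIndicator_eval`). -/
theorem lagrangeIndicator_eigSet_eval (c : F →ₐ[K] F) (x : F) :
    ∀ y ∈ (eigSet K x : Finset L),
      (lagrangeIndicator (eigSet K x : Finset L) (pairSet c x)).eval y = if y ∈ pairSet c x then 1 else 0 :=
  lagrangeIndicator_eval _ _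

end Summit.Ventures.HodgeRepro2.A2EigenvalueSetsStable
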